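import Mathlib.Dynamics.OmegaLimit
import Mathlib.Dynamics.Flow
import Literature.Topology.FourManifolds.LickorishWallaceProofs
import HarnessLib

/-!
# Route PhotonSphereChannels · crux `ChannelsResolveTameDevelopmentsR` (K2R, stmt-FinalStateConjecture-14075) —
# the hull dichotomy (first lemma `HullDichotomy` of the crux cards `kerr-isolation-dichotomy` /
# `isolated-kerr-connected-hull`), proved

The point-set core shared by the two "isolation + connectedness" cards of this crux
(`Cruxes/ChannelsResolveTameDevelopmentsR/SketchIdeator1.lean`, `def HullDichotomy`): for a continuous real flow
`ϕ` on a compact Hausdorff space `H`, the ω-limit set of a point is (pre)connected; hence if it lies in a closed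
set `S` (the silent hull elements) inside which `K` (the Kerr stratum) is closed and relatively open
(ISOLATION, `∃ U open, U ∩ S = K`), then the ω-limit set lies inside `K` or misses `K` (CAPTURE OR AVOIDANCE).

Contents. §1 `subset_or_disjoint_of_isPreconnected` — a preconnected subset of `S` cannot straddle a subset `K`
that is closed and relatively open in `S`. §2 `omegaLimit_singleton_eq_iInter_nat` — the ω-limit set of a point
under a flow as the nested intersection `⋂ₙ closure (ϕ([n, ∞)) x)`; `isPreconnected_omegaLimit_singleton` — it is
preconnected on a compact Hausdorff phase space (nested continua,
`Literature.Topology.FourManifolds.isPreconnected_iInter_of_antitone`). §3 `hullDichotomy` — the statement of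
`SketchIdeator1.HullDichotomy` VERBATIM, now a theorem (the crux-triage proof `Triage_r1_k2_HullDichotomy.lean`
of refuter-cruxtri-…-r1-2, adapted and landed). What is NOT here: any Lorentzian geometry — the hull, its topology
and the isolation of Kerr inside it are what the (dead) lines `kerr-isolation-dichotomy` / `isolated-kerr-connected-hull`
could not supply (`Lines/*-dead.md`); this file is the part of those cards that is a theorem.

References: Hale 1980, Ch. I §8, Lemma 8.1 (ω-limit sets of precompact positive orbits are nonempty, compact,
invariant and connected) [Hale1980]; Walters 1982, §5.2 [Walters1982].
-/

-- every `Summit.FinalStateConjecture.FinalStateConjecture.…` name repeats the summit = sub-problem segment (D-0017 layout)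
set_option linter.dupNamespace false

open Set Filter Function
open scoped Topology

namespace Summit.FinalStateConjecture.FinalStateConjecture.Theorems.HullTopology

/-! ### §1 A preconnected set cannot straddle a relatively clopen subset -/

/-- If `Ω ⊆ S` is preconnected and `K = U ∩ S` is closed (in the ambient space) and relatively open in `S`
(`U` open), then `Ω ⊆ K` or `Ω ∩ K = ∅`. Hale 1980, Ch. I §8 (the use made of connectedness of limit sets). [folklore] -/
theorem subset_or_disjoint_of_isPreconnected {H : Type*} [TopologicalSpace H]
    {Ω S K U : Set H} (hΩ : IsPreconnected Ω) (hK : IsClosed K) (hU : IsOpen U)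
    (hUK : U ∩ S = K) (hΩS : Ω ⊆ S) : Ω ⊆ K ∨ Disjoint Ω K := by
  classical
  by_cases h : (Ω ∩ K).Nonempty
  · left
    have hKU : K ⊆ U := fun y hy ↦ (hUK.symm ▸ hy : y ∈ U ∩ S).1
    have hcover : Ω ⊆ U ∪ Kᶜ := fun y _ ↦ by
      by_cases hy : y ∈ K
      · exact Or.inl (hKU hy)
      · exact Or.inr hy
    have hmeetU : (Ω ∩ U).Nonempty := by
      obtain ⟨y, hyΩ, hyK⟩ := h
      exact ⟨y, hyΩ, hKU hyK⟩
    intro y hyΩ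
    by_contra hyK
    have hmeetC : (Ω ∩ Kᶜ).Nonempty := ⟨y, hyΩ, hyK⟩
    obtain ⟨z, hzΩ, hzU, hzC⟩ := hΩ U Kᶜ hU hK.isOpen_compl hcover hmeetU hmeetC
    exact hzC (hUK ▸ ⟨hzU, hΩS hzΩ⟩ : z ∈ K)
  · right
    exact Set.disjoint_iff_inter_eq_empty.mpr (Set.not_nonempty_iff_eq_empty.mp h)

/-! ### §2 ω-limit sets of points under flows on compact Hausdorff spaces are connected -/

/-- The ω-limit set of a point `x` under a continuous real flow `ϕ`, as the nested intersection over `n : ℕ` of the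
closures of the orbit tails `ϕ([n, ∞)) x`. Hale 1980, Ch. I §8 (definition of `ω(x)` as `⋂_τ cl γ⁺(ϕ_τ x)`). [folklore] -/
theorem omegaLimit_singleton_eq_iInter_nat {H : Type*} [TopologicalSpace H] (ϕ : Flow ℝ H) (x : H) :
    omegaLimit atTop (fun t y ↦ ϕ t y) {x} = ⋂ n : ℕ, closure ((fun t : ℝ ↦ ϕ t x) '' Ici (n : ℝ)) := by
  ext y
  simp only [omegaLimit_def, mem_iInter, image2_singleton_right]
  constructor
  · intro h n
    exact h (Ici (n : ℝ)) (Ici_mem_atTop _)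
  · intro h u hu
    obtain ⟨a, ha⟩ := mem_atTop_sets.1 hu
    have hsub : Ici (⌈a⌉₊ : ℝ) ⊆ u := fun t ht ↦ ha t (le_trans (Nat.le_ceil a) ht)
    exact closure_mono (image_mono hsub) (h ⌈a⌉₊)

/-- **ω-limit sets of points are connected.** For a continuous real flow on a compact Hausdorff space, the ω-limit
set of every point is preconnected: it is the intersection of the decreasing sequence of continua
`cl ϕ([n, ∞)) x` (continuous images of the connected half-lines `[n, ∞)`), and a nested intersection of continua in a
Hausdorff space is preconnected. Hale 1980, Ch. I §8, Lemma 8.1; Walters 1982, §5.2. [cite: Hale1980, Ch. I §8, Lemma 8.1] -/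
theorem isPreconnected_omegaLimit_singleton {H : Type*} [TopologicalSpace H] [CompactSpace H] [T2Space H]
    (ϕ : Flow ℝ H) (x : H) : IsPreconnected (omegaLimit atTop (fun t y ↦ ϕ t y) {x}) := by
  rw [omegaLimit_singleton_eq_iInter_nat]
  refine Literature.Topology.FourManifolds.isPreconnected_iInter_of_antitone ?_ ?_ ?_
  · intro m n hmn
    exact closure_mono (image_mono (Ici_subset_Ici.2 (by exact_mod_cast hmn)))
  · intro n
    exact isClosed_closure.isCompact
  · intro n
    refine (IsPreconnected.image isPreconnected_Ici _ ?_).closure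
    exact (ϕ.continuous continuous_id continuous_const).continuousOn

/-! ### §3 The hull dichotomy of the crux cards, verbatim -/

/-- **Hull dichotomy** (first lemma `HullDichotomy` of the crux cards `kerr-isolation-dichotomy` /
`isolated-kerr-connected-hull` of crux K2R, `Cruxes/ChannelsResolveTameDevelopmentsR/SketchIdeator1.lean`, VERBATIM
its body): for a continuous flow on a compact Hausdorff space `H`, if the ω-limit set of a point lies in a closed
set `S` inside which `K` is closed and relatively open (`∃ U` open with `U ∩ S = K` — isolation), then the
ω-limit set lies in `K` or misses `K`. Proof: §2 (connectedness of ω-limit sets, Hale 1980 Ch. I §8 Lemma 8.1)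
and §1. [cite: Hale1980, Ch. I §8, Lemma 8.1] -/
theorem hullDichotomy :
    ∀ (H : Type) [TopologicalSpace H] [CompactSpace H] [T2Space H] (ϕ : Flow ℝ H)
      (S K : Set H) (x : H),
      IsClosed S → IsClosed K → K ⊆ S → (∃ U : Set H, IsOpen U ∧ U ∩ S = K) →
      omegaLimit atTop (fun t y ↦ ϕ t y) {x} ⊆ S →
      omegaLimit atTop (fun t y ↦ ϕ t y) {x} ⊆ K ∨
        Disjoint (omegaLimit atTop (fun t y ↦ ϕ t y) {x}) K := by
  intro H _ _ _ ϕ S K x _hS hK _hKS hU hΩS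
  obtain ⟨U, hUo, hUK⟩ := hU
  exact subset_or_disjoint_of_isPreconnected (isPreconnected_omegaLimit_singleton ϕ x) hK hUo hUK hΩS

end Summit.FinalStateConjecture.FinalStateConjecture.Theorems.HullTopology
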